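import Mathlib
import Literature.Analysis.FluidPDE.VectorCalculus
import Literature.Geometry.DiscreteGeometry.LayerShells
import Summits.NavierStokesRegularity.NavierStokesRegularity.Theorems.ThreadingFluxAzimuthalCartanDefs
import Summits.NavierStokesRegularity.NavierStokesRegularity.Theorems.ThreadingFluxAzimuthalCartanLocalCurlCurl
import Summits.NavierStokesRegularity.NavierStokesRegularity.Theorems.ThreadingFluxAzimuthalCartanConicalCorrespondence
import Summits.NavierStokesRegularity.NavierStokesRegularity.Theorems.ThreadingFluxAzimuthalCartanConicalSteadyNS
import Summits.NavierStokesRegularity.NavierStokesRegularity.Theorems.ThreadingFluxAzimuthalCartanConicalHead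
import Summits.NavierStokesRegularity.NavierStokesRegularity.Theorems.ThreadingFluxAzimuthalCartanConicalHeadIntegral
import Summits.NavierStokesRegularity.NavierStokesRegularity.Theorems.ThreadingFluxAzimuthalCartanConicalTangentialPotential
import Summits.NavierStokesRegularity.NavierStokesRegularity.Theorems.ThreadingFluxHorizonTowerZonalForm
import Summits.NavierStokesRegularity.NavierStokesRegularity.Theorems.ThreadingFluxHorizonTowerProfileFormulas
import Summits.NavierStokesRegularity.NavierStokesRegularity.Theorems.ThreadingFluxCentreJetPoloidalRepresentation
import HarnessLib

/-!
# Crux `PoloidalLiouville` (stmt-NavierStokesRegularity-1222, wall W1), crux idea «azimuthal-cartan-test» (ns-idea-15 g10):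
# ŠVERÁK'S LOCAL SYSTEM ON A CONE — the local converse of the conformal correspondence, and the image of the correspondence

Support file (`--supports stmt-NavierStokesRegularity-1222`, helper; cell `ns-wall-extremal`, width hand ns-wall-eng-6 g8, 0 kit).  (Λ5c) of
the eng-6 lineage, third slice of the local converse of Šverák's conformal correspondence (C2 `LiouvilleCone.correspondence`; Λ5a
`…ConicalHeadIntegral` = the head `k₀`; Λ5b `…ConicalTangentialPotential` = the potential `Φ` and the first equation).

Šverák (arXiv:math/0604550 §4, (S) → (E2)): with `u = ∇φ + fσ` on `S²`, `w = 2 + f`, the steady system becomes `Δ_{S²}φ = 2 − w` and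
`−Δ_{S²}w + div_{S²}(w∇φ) = 2k₀` ((E2), `k₀` the Bernoulli constant); on the WHOLE sphere two integrations give `k₀ = 0`, `w = 2e^{φ}`
((E3)–(E4), the tree's `Literature…Sverak2011.exists_conformal_potential`), i.e. LIOUVILLE'S EQUATION — the data of the constructive
correspondence (`LiouvilleCone`, C1/C2).  HERE, on a cone, for the UNTHREADED `(−1)`-homogeneous steady stratum (`IsSteadyNSOn`,
`IsUnthreadedOn U 0`, `IsMinusOneHomogeneousOn U 0`, pressure normalised `Dp(x) x = −2p(x)`), in `ℝ³` form (`Δ_{S²} = |x|²Δ` on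
`0`-homogeneous functions), writing `F = ⟪x, u⟫`, `w = 2 + F`, `V = u − (F/|x|²)x` and `Φ` for any tangential potential (`DΦ = ⟪V, ·⟫`):

* ★ `inner_gradient_inner_self_eq` — the RADIAL MOMENTUM BALANCE `⟪u, ∇F⟫ = div ∇F + 2p + |u|²` (bulk form of Šverák's `f`-equation
  `−Δf + v·∇f = f² + |v|² + 2p`; the tree's global `Sverak2011.radialF_identity_on` needs globally smooth regularisations — this is the
  pointwise version from Λ5a's Laplacian formula and spin identity);
* ★★ `sverak_second_equation` — **`|x|²(−Δw + div(w ∇Φ)) = 2·conicalHead u p`** at every point of `U ∖ {0}`: the SECOND equation of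
  Šverák's system with the integration constant KEPT and IDENTIFIED as the head of Λ4a/Λ5a;
* ★★ `exists_sverakSystem_of_convex` — THE LOCAL CONVERSE OF THE CORRESPONDENCE: on a CONVEX open cone `U ∌ 0` every member of the
  stratum (`u ∈ C³`, `p ∈ C¹` from `IsSteadyNSOn`) is `u = ∇Φ + ((w − 2)/|x|²) x` with `⟪x, ∇Φ⟫ = 0`, `|x|²ΔΦ = 2 − w`,
  `|x|²(−Δw + div(w∇Φ)) = 2k₀` and `conicalHead u p ≡ k₀`;
* THE IMAGE OF THE CORRESPONDENCE = `{w = 2e^{Φ}}`: ★ `conicalField_of_weight` / `conicalPressure_of_weight` (if `2 + ⟪x,u⟫ = 2e^{Φ}` on `U`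
  then `u = conicalField Φ` and `p = conicalPressure Φ` there), ★ `liouville_of_weight` (then `|x|²ΔΦ + 2e^{Φ} − 2 = 0`: LIOUVILLE'S EQUATION,
  the `liouville` field of `LiouvilleCone` with `Δ` for `tr H`), ★ `conicalHead_eq_zero_of_weight` (then `k₀ = 0`, because `∇w = w∇Φ`
  makes `−Δw + div(w∇Φ)` vanish), ★★ `liouvilleCone_of_weight` (for real-analytic `u`, `Φ = log((2 + ⟪y,u⟫)/2)` then IS Liouville
  data: `LiouvilleCone U Φ ∇Φ D∇Φ`, C1's structure) and ★★★ `eq_conical_of_weight` (the bundle: Liouville data + `u = conicalField Φ` +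
  `p = conicalPressure Φ` — the input and output of C2's correspondence) — and conversely on the image `w = 2e^{Φ}` holds by C2/Λ2
  `LiouvilleCone.inner_self_conicalField` (`weight_conicalField`).  So on a cone the conformal correspondence is EXACTLY the sub-locus `{w = 2e^{φ}}` of Šverák's local
  system, inside `{k₀ = 0}` and strictly smaller (Λ4c: the Slezkin member `β = 0` has head `β − β²/2 = 0` and is outside the image on
  every cone, `slezkinField_ne_conicalField`); the other Slezkin flows (`k₀ = β − β²/2 ≠ 0`) are explicit members off `{k₀ = 0}`.

HONEST FRAME / LABEL (director-ns g19 p123, critic BATCH #25): SCOPE/SPECIAL-class support (steady `(−1)`-homogeneous unthreaded class),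
information-grade, explicit local vector calculus strictly below W1; closes no crux and no sketch Prop (I♭, C♯ stay conjectures; the
converse is local — on convex sub-cones — and says nothing about caps that are not convex cones); W1 movement 0; `PoloidalLiouville` (1222)
and NS regularity are OPEN / NOT proved.

## References
* V. Šverák, On Landau's solutions of the Navier–Stokes equations, J. Math. Sci. 179 (2011) 208–228, arXiv:math/0604550, §4 ((S), (E2)–(E4)).
  [Sverak2011]
* L. Li, Y. Y. Li, X. Yan, Homogeneous solutions of stationary Navier–Stokes equations with isolated singularities on the unit sphere, I,
  arXiv:1609.08197 (the local conformal description `u_tan = ∇φ`).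
-/

-- the summit and its single sub-problem share the name (CONVENTIONS §1)
set_option linter.dupNamespace false

noncomputable section

namespace Summit.NavierStokesRegularity.NavierStokesRegularity.Theorems.PoloidalLiouville.AzimuthalCartan

open Set Function Filter Topology Metric
open scoped RealInnerProductSpace ContDiff
open Literature.Analysis.FluidPDE
open Literature.Geometry.DiscreteGeometry (inner_fin3)
open Summit.NavierStokesRegularity.NavierStokesRegularity.Theorems.PoloidalLiouville.CentreJet
  (E3 IsSteadyNSOn laplacian_eq_divergence_of_hasFDerivAt_innerSL)
open Summit.NavierStokesRegularity.NavierStokesRegularity.Cruxes.ScarEnvelopeTypeI.ForcedTsai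
  (gradient_eq_of_hasFDerivAt_innerSL fderiv_eq_innerSL_gradient')
open Summit.NavierStokesRegularity.NavierStokesRegularity.Theorems.PoloidalLiouville.HorizonTower (cross_fin3)
open Summit.NavierStokesRegularity.NavierStokesRegularity.Theorems.PoloidalLiouville.AzimuthalCartan.LocalCurlCurl
  (divergence_eventuallyEq_of_eventuallyEq)

/-! ### The radial momentum balance -/

section Radial

variable {U : Set E3} {u : E3 → E3} {p : E3 → ℝ} {x : E3}

/-- ★ **The radial momentum balance** (bulk, pointwise form of Šverák's `f`-equation `−Δ_{S²}f + v·∇f = f² + |v|² + 2p`): on the unthreaded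
`(−1)`-homogeneous steady stratum with normalised pressure, `⟪u, ∇F⟫ = div ∇F + 2p + |u|²` at every `x ∈ U ∖ {0}`, `F = ⟪·, u⟫`. -/
theorem inner_gradient_inner_self_eq (hU : IsOpen U) (hNS : IsSteadyNSOn U u p) (hunth : IsUnthreadedOn U 0 u)
    (hhom : IsMinusOneHomogeneousOn U 0 u) (hp : ∀ y ∈ U, fderiv ℝ p y y = -2 * p y) (hx : x ∈ U) (hx0 : x ≠ 0) :
    ⟪u x, gradient (fun y : E3 => ⟪y, u y⟫) x⟫ =
      VectorCalculus.divergence (gradient fun y : E3 => ⟪y, u y⟫) x + 2 * p x + ‖u x‖ ^ 2 := by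
  obtain ⟨hu3, hp1, hdiv, hns⟩ := hNS
  have hu2 : ContDiffOn ℝ 2 u U := hu3.of_le (by norm_num)
  have hEu : ∀ y ∈ U, fderiv ℝ u y y = -u y := fun y hy => by simpa using hhom y hy
  have hrad : ∀ y ∈ U, ⟪y, curl u y⟫ = 0 := fun y hy => by simpa using hunth y hy
  have hne : ‖x‖ ^ 2 ≠ 0 := pow_ne_zero 2 (norm_ne_zero_iff.mpr hx0)
  set D : E3 →L[ℝ] E3 := fderiv ℝ u x with hD
  have hud : HasFDerivAt u D x := ((hu3.contDiffAt (hU.mem_nhds hx)).differentiableAt (by norm_num)).hasFDerivAt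
  set F : E3 → ℝ := fun y => ⟪y, u y⟫ with hF_def
  set b : E3 := curl u x with hb_def
  set g : E3 := cross x b with hg_def
  have hcurlD : curlCLM D = b := by rw [hb_def, curl_eq_curlCLM]
  have hFd : HasFDerivAt F (innerSL ℝ g) x := by
    have h := hasFDerivAt_inner_self hud (hEu x hx)
    rwa [hcurlD] at h
  have hgF : gradient F x = g := gradient_eq_of_hasFDerivAt_innerSL hFd
  have hgx : ⟪g, x⟫ = 0 := by
    obtain ⟨c0, c1, c2⟩ := cross_fin3 x b
    rw [hg_def, inner_fin3, c0, c1, c2]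
    ring
  have hbg : b = (‖x‖ ^ 2)⁻¹ • cross g x := eq_inv_norm_sq_smul_cross_of_eq_cross hx0 (hrad x hx) rfl
  set m : ℝ := VectorCalculus.divergence (gradient F) x with hm_def
  have hΔ : Laplacian.laplacian u x = (‖x‖ ^ 2)⁻¹ • (g + m • x) := by
    have h := laplacian_eq_of_unthreaded hU hu2 hdiv hEu hrad hx hx0
    rw [hgF] at h
    exact h
  set ρ : ℝ := (‖x‖ ^ 2)⁻¹ with hρ_def
  have en : ρ * ‖x‖ ^ 2 = 1 := inv_mul_cancel₀ hne
  have h1 : ⟪u x, D x⟫ = ⟪D (u x), x⟫ + ⟪cross (u x) b, x⟫ := by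
    have h := inner_apply_sub_inner_apply_eq D (u x) x
    rw [hcurlD] at h
    linarith
  have h2 : ⟪D (u x), x⟫ + fderiv ℝ p x x = ρ * (⟪g, x⟫ + m * ⟪x, x⟫) := by
    have h := congrArg (fun v : E3 => ⟪v, x⟫) (hns x hx)
    rw [hΔ, inner_add_left, real_inner_smul_left, inner_add_left, real_inner_smul_left] at h
    rw [fderiv_eq_innerSL_gradient', innerSL_apply_apply]
    exact h
  have h3 : ⟪cross (u x) b, x⟫ = ρ * (F x * ⟪g, x⟫ - ⟪u x, g⟫ * ⟪x, x⟫) := by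
    rw [hbg, Literature.Analysis.FluidPDE.cross_smul_right, cross_cross_eq, real_inner_smul_left, inner_sub_left, real_inner_smul_left,
      real_inner_smul_left, real_inner_comm x (u x)]
  rw [hEu x hx, inner_neg_right, real_inner_self_eq_norm_sq] at h1
  rw [hp x hx, hgx, real_inner_self_eq_norm_sq] at h2
  rw [hgx, real_inner_self_eq_norm_sq] at h3
  rw [hgF]
  linear_combination h1 + h2 + h3 - (⟪u x, g⟫ - m) * en

end Radial

/-! ### The second equation of Šverák's system, with its constant identified -/

section Second

variable {U : Set E3} {u : E3 → E3} {p : E3 → ℝ} {Φ : E3 → ℝ} {x : E3}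

/-- ★★ **Šverák's second equation, constant included**: on the unthreaded `(−1)`-homogeneous steady stratum with normalised pressure, for
any tangential potential `Φ` (`DΦ = ⟪u − (F/|x|²)x, ·⟫` on `U`) and `w = 2 + ⟪x, u⟫`:
**`|x|² (−Δw + div(w ∇Φ))(x) = 2 · conicalHead u p (x)`** at every `x ∈ U ∖ {0}` (Šverák's (E2) `−Δ_{S²}w + div_{S²}(w∇φ) = 2k₀`, the
constant being the head of Λ4a/Λ5a, constant on preconnected `U` by `exists_conicalHead_eq_const`). -/
theorem sverak_second_equation (hU : IsOpen U) (hNS : IsSteadyNSOn U u p) (hunth : IsUnthreadedOn U 0 u)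
    (hhom : IsMinusOneHomogeneousOn U 0 u) (hp : ∀ y ∈ U, fderiv ℝ p y y = -2 * p y)
    (hΦ : ∀ y ∈ U, HasFDerivAt Φ (innerSL ℝ (u y - (⟪y, u y⟫ / ‖y‖ ^ 2) • y)) y) (hx : x ∈ U) (hx0 : x ≠ 0) :
    ‖x‖ ^ 2 * (-Laplacian.laplacian (fun y : E3 => 2 + ⟪y, u y⟫) x +
        VectorCalculus.divergence (fun y : E3 => (2 + ⟪y, u y⟫) • gradient Φ y) x) = 2 * conicalHead u p x := by
  have hu2 : ContDiffOn ℝ 2 u U := hNS.1.of_le (by norm_num)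
  have hdiv : ∀ y ∈ U, VectorCalculus.divergence u y = 0 := hNS.2.2.1
  have hEu : ∀ y ∈ U, fderiv ℝ u y y = -u y := fun y hy => by simpa using hhom y hy
  have hne : ‖x‖ ^ 2 ≠ 0 := pow_ne_zero 2 (norm_ne_zero_iff.mpr hx0)
  have hud : HasFDerivAt u (fderiv ℝ u x) x := ((hNS.1.contDiffAt (hU.mem_nhds hx)).differentiableAt (by norm_num)).hasFDerivAt
  set F : E3 → ℝ := fun y => ⟪y, u y⟫ with hF_def
  set V : E3 → E3 := fun y => u y - (⟪y, u y⟫ / ‖y‖ ^ 2) • y with hV_def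
  have hF2 : ContDiffOn ℝ 2 F U := contDiffOn_id.inner ℝ hu2
  obtain ⟨hH, hgrad⟩ := hasFDerivAt_gradient_of_contDiffOn hU hF2 hx
  have hgx : ⟪gradient F x, x⟫ = 0 := by
    rw [real_inner_comm]
    exact inner_self_gradient_inner_self hud (hEu x hx)
  -- (a) `Δw = div ∇F`
  have hw : ∀ z ∈ U, HasFDerivAt (fun y : E3 => 2 + F y) (innerSL ℝ (gradient F z)) z := fun z hz => (hgrad z hz).const_add 2
  have hΔw : Laplacian.laplacian (fun y : E3 => 2 + ⟪y, u y⟫) x = VectorCalculus.divergence (gradient F) x :=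
    laplacian_eq_divergence_of_hasFDerivAt_innerSL hU hw hx hH.differentiableAt
  -- (b) `div (w ∇Φ) = w div V + ⟪∇F, V⟫ = −w F/|x|² + ⟪∇F, u⟫`
  have hVx := hasFDerivAt_tangential hud (hEu x hx) hx0
  have hev : (fun y : E3 => (2 + ⟪y, u y⟫) • gradient Φ y) =ᶠ[𝓝 x] fun y => (2 + F y) • V y := by
    filter_upwards [hU.mem_nhds hx] with y hy
    rw [gradient_potential hΦ hy]
  have hdivw : VectorCalculus.divergence (fun y : E3 => (2 + ⟪y, u y⟫) • gradient Φ y) x =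
      (2 + F x) * (-⟪x, u x⟫ / ‖x‖ ^ 2) + ⟪gradient F x, u x⟫ := by
    rw [(divergence_eventuallyEq_of_eventuallyEq hev).eq_of_nhds,
      HorizonTower.divergence_smul_apply (hw x hx).differentiableAt hVx.differentiableAt,
      divergence_tangential hud (hEu x hx) hx0 (hdiv x hx), (hw x hx).fderiv, innerSL_apply_apply]
    simp only [inner_sub_right, inner_smul_right, hgx, mul_zero, sub_zero]
  -- (c) the radial balance and the head
  have hrad : ⟪gradient F x, u x⟫ = VectorCalculus.divergence (gradient F) x + 2 * p x + ‖u x‖ ^ 2 := by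
    rw [real_inner_comm]
    exact inner_gradient_inner_self_eq hU hNS hunth hhom hp hx hx0
  rw [hΔw, hdivw, hrad]
  have e1 : F x = ⟪x, u x⟫ := rfl
  rw [e1]
  simp only [conicalHead]
  field_simp
  ring

end Second

/-! ### The local converse of the correspondence, packaged -/

section Converse

variable {U : Set E3} {u : E3 → E3} {p : E3 → ℝ}

/-- ★★ **THE LOCAL CONVERSE OF ŠVERÁK'S CONFORMAL CORRESPONDENCE.**  On a CONVEX open cone `U ∌ 0`, every member `(u, p)` of the unthreaded
`(−1)`-homogeneous steady stratum (`IsSteadyNSOn U u p`, `IsUnthreadedOn U 0 u`, `IsMinusOneHomogeneousOn U 0 u`, `Dp(y) y = −2p(y)`) has a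
tangential potential `Φ` and a head constant `k₀` with, writing `w = 2 + ⟪y, u⟫`:
`u = ∇Φ + ((w − 2)/|y|²) y`, `⟪y, ∇Φ⟫ = 0`, `|y|²ΔΦ = 2 − w`, `|y|²(−Δw + div(w∇Φ)) = 2k₀`, `conicalHead u p ≡ k₀` on `U` — Šverák's system
(S)/(E2) on the cone, with its integration constant.  (The image of the correspondence is the sub-locus `w = 2e^{Φ}`, below.) -/
theorem exists_sverakSystem_of_convex (hU : IsOpen U) (hUc : Convex ℝ U) (h0 : ∀ y ∈ U, y ≠ 0) (hNS : IsSteadyNSOn U u p)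
    (hunth : IsUnthreadedOn U 0 u) (hhom : IsMinusOneHomogeneousOn U 0 u) (hp : ∀ y ∈ U, fderiv ℝ p y y = -2 * p y) :
    ∃ (Φ : E3 → ℝ) (k₀ : ℝ),
      (∀ y ∈ U, HasFDerivAt Φ (innerSL ℝ (u y - (⟪y, u y⟫ / ‖y‖ ^ 2) • y)) y) ∧
      (∀ y ∈ U, u y = gradient Φ y + ((2 + ⟪y, u y⟫ - 2) / ‖y‖ ^ 2) • y) ∧
      (∀ y ∈ U, ⟪y, gradient Φ y⟫ = 0) ∧
      (∀ y ∈ U, ‖y‖ ^ 2 * Laplacian.laplacian Φ y = 2 - (2 + ⟪y, u y⟫)) ∧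
      (∀ y ∈ U, ‖y‖ ^ 2 * (-Laplacian.laplacian (fun z : E3 => 2 + ⟪z, u z⟫) y +
          VectorCalculus.divergence (fun z : E3 => (2 + ⟪z, u z⟫) • gradient Φ z) y) = 2 * k₀) ∧
      (∀ y ∈ U, conicalHead u p y = k₀) := by
  have hu1 : ContDiffOn ℝ 1 u U := hNS.1.of_le (by norm_num)
  have hEu : ∀ y ∈ U, fderiv ℝ u y y = -u y := fun y hy => by simpa using hhom y hy
  have hrad : ∀ y ∈ U, ⟪y, curl u y⟫ = 0 := fun y hy => by simpa using hunth y hy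
  obtain ⟨Φ, hΦ⟩ := exists_tangential_potential_of_convex hU hUc h0 hu1 hEu hrad
  obtain ⟨k₀, hk₀⟩ := exists_conicalHead_eq_const hU hUc.isPreconnected h0 hNS hunth hhom hp
  refine ⟨Φ, k₀, hΦ, fun y hy => eq_gradient_potential_add hΦ hy, fun y hy => inner_self_gradient_potential hΦ hy (h0 y hy),
    fun y hy => norm_sq_mul_laplacian_potential hU h0 hu1 hNS.2.2.1 hEu hΦ hy, fun y hy => ?_, hk₀⟩
  rw [sverak_second_equation hU hNS hunth hhom hp hΦ hy (h0 y hy), hk₀ y hy]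

end Converse

/-! ### The image of the correspondence inside Šverák's local system: `w = 2e^{Φ}` -/

section Image

variable {U : Set E3} {u : E3 → E3} {p : E3 → ℝ} {Φ : E3 → ℝ} {x : E3}

/-- On the image of the correspondence the conformal weight is `w = 2e^{Φ}` (C2/Λ2 `LiouvilleCone.inner_self_conicalField`). -/
theorem LiouvilleCone.weight_conicalField {g : E3 → E3} {H : E3 → E3 →L[ℝ] E3} (hc : LiouvilleCone U Φ g H) (hx : x ∈ U) :
    2 + ⟪x, conicalField Φ x⟫ = 2 * Real.exp (Φ x) := by
  rw [hc.inner_self_conicalField hx]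
  ring

/-- ★ **`w = 2e^{Φ}` forces the velocity to be the conical field of `Φ`**: if `Φ` is a tangential potential of `u` on `U` and
`2 + ⟪y, u(y)⟫ = 2e^{Φ(y)}` on `U`, then `u = conicalField Φ = ∇Φ + ((2e^{Φ} − 2)/|y|²) y` on `U` (pure algebra). -/
theorem conicalField_of_weight (hΦ : ∀ y ∈ U, HasFDerivAt Φ (innerSL ℝ (u y - (⟪y, u y⟫ / ‖y‖ ^ 2) • y)) y)
    (hwt : ∀ y ∈ U, 2 + ⟪y, u y⟫ = 2 * Real.exp (Φ y)) (hx : x ∈ U) : u x = conicalField Φ x := by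
  have hF : 2 * Real.exp (Φ x) - 2 = ⟪x, u x⟫ := by linarith [hwt x hx]
  rw [conicalField, radialCoeff, gradient_potential hΦ hx, hF, sub_add_cancel]

/-- ★ **`w = 2e^{Φ}` turns the first equation into LIOUVILLE'S EQUATION** `|x|²ΔΦ + 2e^{Φ} − 2 = 0` (the `liouville` field of `LiouvilleCone`,
with `ΔΦ` for the trace of the Hessian) — kinematics only: `u ∈ C¹(U)` divergence-free with Euler's relation, `0 ∉ U`. -/
theorem liouville_of_weight (hU : IsOpen U) (h0 : ∀ y ∈ U, y ≠ 0) (hu : ContDiffOn ℝ 1 u U)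
    (hdiv : ∀ y ∈ U, VectorCalculus.divergence u y = 0) (hEu : ∀ y ∈ U, fderiv ℝ u y y = -u y)
    (hΦ : ∀ y ∈ U, HasFDerivAt Φ (innerSL ℝ (u y - (⟪y, u y⟫ / ‖y‖ ^ 2) • y)) y)
    (hwt : ∀ y ∈ U, 2 + ⟪y, u y⟫ = 2 * Real.exp (Φ y)) (hx : x ∈ U) :
    ‖x‖ ^ 2 * Laplacian.laplacian Φ x + 2 * Real.exp (Φ x) - 2 = 0 := by
  have h := norm_sq_mul_laplacian_potential hU h0 hu hdiv hEu hΦ hx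
  rw [hwt x hx] at h
  linarith

/-- ★ **`w = 2e^{Φ}` forces the head to vanish**: then `∇w = w∇Φ`, so `−Δw + div(w∇Φ) = −div(w∇Φ) + div(w∇Φ) = 0` and the second equation
gives `conicalHead u p = 0` — the image of the correspondence lies in `{k₀ = 0}` (consistent with Λ4a `LiouvilleCone.conicalHead_eq_zero`). -/
theorem conicalHead_eq_zero_of_weight (hU : IsOpen U) (hNS : IsSteadyNSOn U u p) (hunth : IsUnthreadedOn U 0 u)
    (hhom : IsMinusOneHomogeneousOn U 0 u) (hp : ∀ y ∈ U, fderiv ℝ p y y = -2 * p y)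
    (hΦ : ∀ y ∈ U, HasFDerivAt Φ (innerSL ℝ (u y - (⟪y, u y⟫ / ‖y‖ ^ 2) • y)) y)
    (hwt : ∀ y ∈ U, 2 + ⟪y, u y⟫ = 2 * Real.exp (Φ y)) (hx : x ∈ U) (hx0 : x ≠ 0) : conicalHead u p x = 0 := by
  have hne : ‖x‖ ^ 2 ≠ 0 := pow_ne_zero 2 (norm_ne_zero_iff.mpr hx0)
  have hEu : ∀ y ∈ U, fderiv ℝ u y y = -u y := fun y hy => by simpa using hhom y hy
  have hud : HasFDerivAt u (fderiv ℝ u x) x := ((hNS.1.contDiffAt (hU.mem_nhds hx)).differentiableAt (by norm_num)).hasFDerivAt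
  have h2 := sverak_second_equation hU hNS hunth hhom hp hΦ hx hx0
  set V : E3 → E3 := fun y => u y - (⟪y, u y⟫ / ‖y‖ ^ 2) • y with hV_def
  set G : E3 → E3 := fun y => (2 * Real.exp (Φ y)) • V y with hG_def
  -- `∇w = G` on `U`
  have hw : ∀ z ∈ U, HasFDerivAt (fun y : E3 => 2 + ⟪y, u y⟫) (innerSL ℝ (G z)) z := by
    intro z hz
    have h1 : HasFDerivAt (fun y : E3 => 2 * Real.exp (Φ y)) (innerSL ℝ (G z)) z := by
      refine (((hΦ z hz).exp).const_mul 2).congr_fderiv ?_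
      ext v
      simp only [hG_def, smul_apply, innerSL_apply_apply, smul_eq_mul, real_inner_smul_left]
      ring
    refine h1.congr_of_eventuallyEq ?_
    filter_upwards [hU.mem_nhds hz] with y hy using hwt y hy
  have hG : DifferentiableAt ℝ G x :=
    (((hΦ x hx).exp).const_mul 2).differentiableAt.smul (hasFDerivAt_tangential hud (hEu x hx) hx0).differentiableAt
  have hΔ : Laplacian.laplacian (fun y : E3 => 2 + ⟪y, u y⟫) x = VectorCalculus.divergence G x :=
    laplacian_eq_divergence_of_hasFDerivAt_innerSL hU hw hx hG
  -- `w ∇Φ = G` near `x`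
  have hev : (fun y : E3 => (2 + ⟪y, u y⟫) • gradient Φ y) =ᶠ[𝓝 x] G := by
    filter_upwards [hU.mem_nhds hx] with y hy
    rw [hwt y hy, gradient_potential hΦ hy]
  rw [hΔ, (divergence_eventuallyEq_of_eventuallyEq hev).eq_of_nhds, neg_add_cancel, mul_zero] at h2
  linarith

/-- ★ **`w = 2e^{Φ}` forces the pressure to be the conical pressure**: with the head zero and `u = ∇Φ + h·x` (`h = (2e^{Φ} − 2)/|x|²`,
`⟪x, ∇Φ⟫ = 0`), `0 = K = |x|²(½|∇Φ|² + ½h²|x|² + p) − ½h²|x|⁴ − h|x|²` gives `p = h − ½|∇Φ|² = conicalPressure Φ`. -/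
theorem conicalPressure_of_weight (hU : IsOpen U) (hNS : IsSteadyNSOn U u p) (hunth : IsUnthreadedOn U 0 u)
    (hhom : IsMinusOneHomogeneousOn U 0 u) (hp : ∀ y ∈ U, fderiv ℝ p y y = -2 * p y)
    (hΦ : ∀ y ∈ U, HasFDerivAt Φ (innerSL ℝ (u y - (⟪y, u y⟫ / ‖y‖ ^ 2) • y)) y)
    (hwt : ∀ y ∈ U, 2 + ⟪y, u y⟫ = 2 * Real.exp (Φ y)) (hx : x ∈ U) (hx0 : x ≠ 0) : p x = conicalPressure Φ x := by
  have hne : ‖x‖ ^ 2 ≠ 0 := pow_ne_zero 2 (norm_ne_zero_iff.mpr hx0)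
  have hK := conicalHead_eq_zero_of_weight hU hNS hunth hhom hp hΦ hwt hx hx0
  have hu := conicalField_of_weight hΦ hwt hx
  have hg0 : ⟪x, gradient Φ x⟫ = 0 := inner_self_gradient_potential hΦ hx hx0
  have hg0' : ⟪gradient Φ x, x⟫ = 0 := by rw [real_inner_comm]; exact hg0
  have hF : ⟪x, u x⟫ = radialCoeff Φ x * ‖x‖ ^ 2 := by
    rw [hu, conicalField, inner_add_right, inner_smul_right, real_inner_self_eq_norm_sq, hg0, zero_add]
  have hn : ‖u x‖ ^ 2 = ‖gradient Φ x‖ ^ 2 + radialCoeff Φ x ^ 2 * ‖x‖ ^ 2 := by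
    rw [hu, conicalField, ← real_inner_self_eq_norm_sq, inner_add_left, inner_add_right, inner_add_right, inner_smul_left,
      inner_smul_right, inner_smul_left, inner_smul_right, real_inner_self_eq_norm_sq, real_inner_self_eq_norm_sq, hg0, hg0']
    simp
    ring
  unfold conicalHead at hK
  rw [hF, hn] at hK
  unfold conicalPressure
  have h3 : ‖x‖ ^ 2 * (p x - (radialCoeff Φ x - ‖gradient Φ x‖ ^ 2 / 2)) = 0 := by linear_combination hK
  rcases mul_eq_zero.mp h3 with h | h
  · exact absurd h hne
  · linarith

/-- ★★ **`{w = 2e^{Φ}}` IS Liouville data** (kinematics + analyticity): if `u` is real-analytic, divergence-free and `(−1)`-homogeneous on the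
open `U ∌ 0`, `Φ` is a tangential potential and `2 + ⟪y, u⟫ = 2e^{Φ}` on `U`, then `Φ` satisfies every clause of C1's `LiouvilleCone` with
`g = ∇Φ`, `H = D∇Φ` (`Φ = log((2 + ⟪y,u⟫)/2)` is analytic with `u`; Euler from Λ5b; Liouville's equation from `liouville_of_weight`). -/
theorem liouvilleCone_of_weight (hU : IsOpen U) (h0 : ∀ y ∈ U, y ≠ 0) (hua : AnalyticOnNhd ℝ u U)
    (hdiv : ∀ y ∈ U, VectorCalculus.divergence u y = 0) (hhom : IsMinusOneHomogeneousOn U 0 u)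
    (hΦ : ∀ y ∈ U, HasFDerivAt Φ (innerSL ℝ (u y - (⟪y, u y⟫ / ‖y‖ ^ 2) • y)) y)
    (hwt : ∀ y ∈ U, 2 + ⟪y, u y⟫ = 2 * Real.exp (Φ y)) :
    LiouvilleCone U Φ (gradient Φ) (fun y => fderiv ℝ (gradient Φ) y) := by
  have hu1 : ContDiffOn ℝ 1 u U := fun y hy => ((hua y hy).contDiffAt.of_le le_top).contDiffWithinAt
  have hEu : ∀ y ∈ U, fderiv ℝ u y y = -u y := fun y hy => by simpa using hhom y hy
  have hud : ∀ y ∈ U, HasFDerivAt u (fderiv ℝ u y) y := fun y hy =>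
    ((hu1.contDiffAt (hU.mem_nhds hy)).differentiableAt one_ne_zero).hasFDerivAt
  have hgrad : ∀ y ∈ U, HasFDerivAt Φ (innerSL ℝ (gradient Φ y)) y := fun y hy => by
    rw [gradient_potential hΦ hy]
    exact hΦ y hy
  have hgd : ∀ y ∈ U, DifferentiableAt ℝ (gradient Φ) y := fun y hy => by
    have hVd := (hasFDerivAt_tangential (hud y hy) (hEu y hy) (h0 y hy)).differentiableAt
    have hev : gradient Φ =ᶠ[𝓝 y] fun z => u z - (⟪z, u z⟫ / ‖z‖ ^ 2) • z := by
      filter_upwards [hU.mem_nhds hy] with z hz using gradient_potential hΦ hz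
    exact hVd.congr_of_eventuallyEq hev
  refine ⟨hU, h0, fun y hy => ?_, hgrad, fun y hy => (hgd y hy).hasFDerivAt,
    fun y hy => inner_self_gradient_potential hΦ hy (h0 y hy), fun y hy => ?_⟩
  · -- `Φ = log((2 + ⟪y, u⟫)/2)` near `y`, analytic with `u`
    have hpos : 0 < (2 + ⟪y, u y⟫) / 2 := by rw [hwt y hy]; positivity
    have hin : AnalyticAt ℝ (fun z : E3 => (2 + ⟪z, u z⟫) / 2) y := by
      have h1 : ContDiffAt ℝ (⊤ : WithTop ℕ∞) (fun z : E3 => ⟪z, u z⟫) y := contDiffAt_id.inner ℝ (hua y hy).contDiffAt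
      exact (analyticAt_const.add h1.analyticAt).div analyticAt_const two_ne_zero
    have hlog : AnalyticAt ℝ (fun z : E3 => Real.log ((2 + ⟪z, u z⟫) / 2)) y :=
      AnalyticAt.comp (g := Real.log) (f := fun z : E3 => (2 + ⟪z, u z⟫) / 2) (x := y) (analyticAt_log hpos) hin
    refine hlog.congr ?_
    filter_upwards [hU.mem_nhds hy] with z hz
    rw [hwt z hz, mul_div_cancel_left₀ _ two_ne_zero, Real.log_exp]
  · -- Liouville's equation, with `tr D∇Φ = div ∇Φ = ΔΦ`
    have hΔ : Laplacian.laplacian Φ y = VectorCalculus.divergence (gradient Φ) y :=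
      laplacian_eq_divergence_of_hasFDerivAt_innerSL hU hgrad hy (hgd y hy)
    have htr : ∑ i, fderiv ℝ (gradient Φ) y (EuclideanSpace.single i 1) i = VectorCalculus.divergence (gradient Φ) y := by
      rw [VectorCalculus.divergence, trace_eq_sum_coord]
    rw [htr, ← hΔ]
    exact liouville_of_weight hU h0 hu1 hdiv hEu hΦ hwt hy

/-- ★★★ **THE IMAGE OF THE CONFORMAL CORRESPONDENCE IS EXACTLY `{w = 2e^{Φ}}`.**  A real-analytic member `(u, p)` of the unthreaded
`(−1)`-homogeneous steady stratum on the open `U ∌ 0` (normalised pressure) whose conformal weight is `2e^{Φ}` for a tangential potential `Φ`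
IS the conical flow of Liouville data: `LiouvilleCone U Φ ∇Φ D∇Φ`, `u = conicalField Φ`, `p = conicalPressure Φ` on `U` — the input and
output of C2 `LiouvilleCone.correspondence`; with `LiouvilleCone.weight_conicalField` the converse inclusion. -/
theorem eq_conical_of_weight (hU : IsOpen U) (h0 : ∀ y ∈ U, y ≠ 0) (hua : AnalyticOnNhd ℝ u U) (hNS : IsSteadyNSOn U u p)
    (hunth : IsUnthreadedOn U 0 u) (hhom : IsMinusOneHomogeneousOn U 0 u) (hp : ∀ y ∈ U, fderiv ℝ p y y = -2 * p y)
    (hΦ : ∀ y ∈ U, HasFDerivAt Φ (innerSL ℝ (u y - (⟪y, u y⟫ / ‖y‖ ^ 2) • y)) y)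
    (hwt : ∀ y ∈ U, 2 + ⟪y, u y⟫ = 2 * Real.exp (Φ y)) :
    LiouvilleCone U Φ (gradient Φ) (fun y => fderiv ℝ (gradient Φ) y) ∧
      (∀ y ∈ U, u y = conicalField Φ y) ∧ ∀ y ∈ U, p y = conicalPressure Φ y :=
  ⟨liouvilleCone_of_weight hU h0 hua hNS.2.2.1 hhom hΦ hwt, fun _ hy => conicalField_of_weight hΦ hwt hy,
    fun y hy => conicalPressure_of_weight hU hNS hunth hhom hp hΦ hwt hy (h0 y hy)⟩

end Image

end Summit.NavierStokesRegularity.NavierStokesRegularity.Theorems.PoloidalLiouville.AzimuthalCartan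

end
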